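import Mathlib.Analysis.SpecialFunctions.Gaussian.FourierTransform
import Summits.RiemannHypothesis.RiemannHypothesis.Theorems.JensenPolynomialsLaplaceWindow

/-!
# Route `JensenPolynomials`, FAR crux `XiWindowZeroFreeRelFar` (B1-rel) — contour tools III: the effective Laplace window
bound at an APPROXIMATE saddle (linear term allowed) (RH-FREE; cell rh-jensen, HUMAN RULING D-0040)

Companion of `JensenPolynomialsLaplaceWindow.lean` for item `stmt-RiemannHypothesis-19465`. In an effective saddle-point
estimate it is cheaper NOT to solve `P′ = 0` in `ℂ` but to expand the phase at an explicit approximate saddle `u₀`, keeping a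
small linear term: `‖P u − P u₀ − b(u−u₀) + c(u−u₀)²‖ ≤ M|u−u₀|³` on `|u − u₀| ≤ δ` (`Re c > 0`, `Mδ ≤ Re c/4`). Completing
the square, the main term is `∫_ℝ e^{b t − c t²} dt = (π/c)^{1/2}e^{b²/(4c)}` (Mathlib `integral_cexp_quadratic`) and every
error acquires the factor `e^{|b|²/Re c}` (from `|b||t| ≤ |b|²/Re c + (Re c/4)t²`):

* `norm_cexp_phase_lin_sub_le`: `‖e^{P u − P u₀}‖ ≤ e^{|b|²/Re c}·e^{−(Re c/2)(u−u₀)²}` on the window;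
* `norm_integral_window_phase_lin_mul_le` («lineUpper» with drift): `‖∫_win e^{P−P₀}Q‖ ≤ B e^{|b|²/Re c}√(2π/Re c)`;
* `norm_integral_window_phase_lin_sub_main_le` («lineLower» with drift):
  `‖∫_win e^{P−P₀} − (π/c)^{1/2}e^{b²/(4c)}‖ ≤ e^{|b|²/Re c}·(4M/(Re c)² + e^{−Re c·δ²/4}√(2π/Re c))`.

WHAT THIS IS NOT: real analysis with explicit constants (de Bruijn, *Asymptotic Methods in Analysis*, Ch. 4–5); nothing
here bears on the zeros of `ζ` or the truth of RH.
-/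

noncomputable section
-- D-0017: `Summit.RiemannHypothesis.RiemannHypothesis.…` duplicates the namespace BY DESIGN (single-problem summit).
set_option linter.dupNamespace false

namespace Summit.RiemannHypothesis.RiemannHypothesis.Theorems.JensenPolynomials.WindowEGF

open MeasureTheory Set Filter
open scoped Topology Real

/-! ## 1. Pointwise bounds on the window -/

/-- AM–GM in the form used to absorb a linear drift into a quarter of the Gaussian: `β|t| ≤ β²/a + (a/4)t²` (`a > 0`). -/
theorem mul_abs_le_sq_div_add {a : ℝ} (ha : 0 < a) (β t : ℝ) : β * |t| ≤ β ^ 2 / a + a / 4 * t ^ 2 := by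
  have hsq : |t| ^ 2 = t ^ 2 := sq_abs t
  have h2 : β * |t| * a ≤ β ^ 2 + a / 4 * t ^ 2 * a := by
    rw [← hsq]
    nlinarith [sq_nonneg (β - a / 2 * |t|)]
  calc β * |t| = β * |t| * a / a := by field_simp
    _ ≤ (β ^ 2 + a / 4 * t ^ 2 * a) / a := by gcongr
    _ = β ^ 2 / a + a / 4 * t ^ 2 := by field_simp

/-- Real part of the quadratic model: `Re(b·t − c·t²) ≤ |b|²/Re c − (3/4)Re c·t²` for real `t` (`Re c > 0`). -/
theorem re_lin_sub_quad_le {b c : ℂ} (hc : 0 < c.re) (t : ℝ) :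
    (b * (t : ℂ) - c * (t : ℂ) ^ 2).re ≤ ‖b‖ ^ 2 / c.re - 3 / 4 * c.re * t ^ 2 := by
  have h1 : (b * (t : ℂ) - c * (t : ℂ) ^ 2).re = b.re * t - c.re * t ^ 2 := by
    have : ((t : ℂ)) ^ 2 = (((t ^ 2 : ℝ)) : ℂ) := by push_cast; ring
    rw [Complex.sub_re, this, mul_comm c, Complex.re_ofReal_mul, mul_comm b, Complex.re_ofReal_mul]; ring
  have h2 : b.re * t ≤ ‖b‖ * |t| := by
    calc b.re * t ≤ |b.re * t| := le_abs_self _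
      _ = |b.re| * |t| := abs_mul _ _
      _ ≤ ‖b‖ * |t| := by gcongr; exact Complex.abs_re_le_norm b
  have h3 := mul_abs_le_sq_div_add hc ‖b‖ t
  rw [h1]; linarith

/-- On the window, with a drift: `‖e^{P u − P u₀}‖ ≤ e^{|b|²/Re c}·e^{−(Re c/2)(u−u₀)²}`. -/
theorem norm_cexp_phase_lin_sub_le {P : ℝ → ℂ} {u₀ : ℝ} {b c : ℂ} (hc : 0 < c.re) {δ M : ℝ} (hM : 0 ≤ M)
    (hMδ : M * δ ≤ c.re / 4)
    (hT : ∀ u, |u - u₀| ≤ δ → ‖P u - P u₀ - b * (u - u₀) + c * (u - u₀) ^ 2‖ ≤ M * |u - u₀| ^ 3)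
    {u : ℝ} (hu : |u - u₀| ≤ δ) :
    ‖Complex.exp (P u - P u₀)‖ ≤ Real.exp (‖b‖ ^ 2 / c.re) * Real.exp (-(c.re / 2) * (u - u₀) ^ 2) := by
  set z : ℂ := P u - P u₀ - b * (u - u₀) + c * (u - u₀) ^ 2 with hz
  have hzn : ‖z‖ ≤ M * |u - u₀| ^ 3 := hT u hu
  have hz2 : ‖z‖ ≤ c.re / 4 * (u - u₀) ^ 2 := by
    have habs : |u - u₀| ^ 3 = |u - u₀| * (u - u₀) ^ 2 := by rw [pow_succ', sq_abs]
    calc ‖z‖ ≤ M * |u - u₀| ^ 3 := hzn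
      _ = (M * |u - u₀|) * (u - u₀) ^ 2 := by rw [habs, mul_assoc]
      _ ≤ (c.re / 4) * (u - u₀) ^ 2 :=
          mul_le_mul_of_nonneg_right ((mul_le_mul_of_nonneg_left hu hM).trans hMδ) (sq_nonneg _)
  have hdec : P u - P u₀ = (b * (((u - u₀ : ℝ)) : ℂ) - c * (((u - u₀ : ℝ)) : ℂ) ^ 2) + z := by
    rw [hz]; push_cast; ring
  rw [Complex.norm_exp, hdec, Complex.add_re, ← Real.exp_add]
  apply Real.exp_monotone
  have h1 := re_lin_sub_quad_le (b := b) hc (u - u₀)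
  have h2 : z.re ≤ c.re / 4 * (u - u₀) ^ 2 := (Complex.re_le_norm z).trans hz2
  linarith

/-! ## 2. Upper window bound with a drift -/

/-- **Upper window bound with an amplitude, drift allowed.** Under `‖P u − P u₀ − b(u−u₀) + c(u−u₀)²‖ ≤ M|u−u₀|³` on
`|u−u₀| ≤ δ` (`Re c > 0`, `0 ≤ M`, `Mδ ≤ Re c/4`) and `‖Q‖ ≤ B` on the window (`B ≥ 0`):
`‖∫_{u₀−δ}^{u₀+δ} e^{P u − P u₀}Q(u) du‖ ≤ B·e^{|b|²/Re c}·√(2π/Re c)`. -/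
theorem norm_integral_window_phase_lin_mul_le {P : ℝ → ℂ} {u₀ : ℝ} {b c : ℂ} (hc : 0 < c.re)
    {δ M B : ℝ} (hM : 0 ≤ M) (hMδ : M * δ ≤ c.re / 4) (hB : 0 ≤ B)
    (hT : ∀ u, |u - u₀| ≤ δ → ‖P u - P u₀ - b * (u - u₀) + c * (u - u₀) ^ 2‖ ≤ M * |u - u₀| ^ 3)
    {Q : ℝ → ℂ} (hQB : ∀ u ∈ Icc (u₀ - δ) (u₀ + δ), ‖Q u‖ ≤ B) :
    ‖∫ u in Icc (u₀ - δ) (u₀ + δ), Complex.exp (P u - P u₀) * Q u‖ ≤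
      B * Real.exp (‖b‖ ^ 2 / c.re) * Real.sqrt (2 * π / c.re) := by
  have hb2 : 0 < c.re / 2 := by linarith
  have h := norm_setIntegral_le_of_norm_le_gaussian measurableSet_Icc hb2 (by positivity : 0 ≤ B * Real.exp (‖b‖ ^ 2 / c.re))
    (x₀ := u₀) (f := fun u => Complex.exp (P u - P u₀) * Q u) (fun u hu => by
      rw [norm_mul]
      have h1 := norm_cexp_phase_lin_sub_le hc hM hMδ hT (abs_sub_le_of_mem_Icc hu)
      have h2 := hQB u hu
      calc ‖Complex.exp (P u - P u₀)‖ * ‖Q u‖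
          ≤ (Real.exp (‖b‖ ^ 2 / c.re) * Real.exp (-(c.re / 2) * (u - u₀) ^ 2)) * B :=
            mul_le_mul h1 h2 (norm_nonneg _) (by positivity)
        _ = B * Real.exp (‖b‖ ^ 2 / c.re) * Real.exp (-(c.re / 2) * (u - u₀) ^ 2) := by ring)
  have hsq : Real.sqrt (π / (c.re / 2)) = Real.sqrt (2 * π / c.re) := by
    congr 1; field_simp
  rwa [hsq] at h

/-! ## 3. The main term with a drift -/

/-- The drifted Gaussian over `ℝ`: `∫_ℝ e^{b(u−u₀) − c(u−u₀)²} du = (π/c)^{1/2}·e^{b²/(4c)}` (`Re c > 0`). -/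
theorem integral_cexp_lin_sub_quad {b c : ℂ} (hc : 0 < c.re) (u₀ : ℝ) :
    ∫ u : ℝ, Complex.exp (b * (((u : ℂ)) - u₀) - c * (((u : ℂ)) - u₀) ^ 2) =
      (π / c) ^ (1 / 2 : ℂ) * Complex.exp (b ^ 2 / (4 * c)) := by
  have h := integral_sub_right_eq_self (μ := (volume : Measure ℝ))
    (fun t : ℝ => Complex.exp (b * (t : ℂ) - c * (t : ℂ) ^ 2)) u₀
  simp only [Complex.ofReal_sub] at h
  rw [h]
  have hneg : (-c).re < 0 := by simpa using hc
  have hq := integral_cexp_quadratic hneg b 0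
  have hfun : (fun x : ℝ => Complex.exp (-c * (x : ℂ) ^ 2 + b * x + 0)) =
      fun t : ℝ => Complex.exp (b * (t : ℂ) - c * (t : ℂ) ^ 2) := by
    ext x; congr 1; ring
  rw [hfun] at hq
  rw [hq, neg_neg]
  congr 1
  rw [zero_sub, mul_neg, div_neg, neg_neg]

/-- The drifted Gaussian is integrable over `ℝ`. -/
theorem integrable_cexp_lin_sub_quad {b c : ℂ} (hc : 0 < c.re) (u₀ : ℝ) :
    Integrable fun u : ℝ => Complex.exp (b * (((u : ℂ)) - u₀) - c * (((u : ℂ)) - u₀) ^ 2) := by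
  have h := (integrable_cexp_quadratic hc b 0).comp_sub_right u₀
  refine h.congr (Eventually.of_forall fun u => ?_)
  simp only [Complex.ofReal_sub, add_zero]
  congr 1; ring

/-- Pointwise cubic comparison with a drift: with `t = u − u₀`,
`‖e^{P u − P u₀} − e^{bt − ct²}‖ ≤ e^{|b|²/Re c}·M|t|³e^{−(Re c/2)t²}` on the window. -/
theorem norm_cexp_phase_lin_sub_gaussian_le {P : ℝ → ℂ} {u₀ : ℝ} {b c : ℂ} (hc : 0 < c.re) {δ M : ℝ} (hM : 0 ≤ M)
    (hMδ : M * δ ≤ c.re / 4)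
    (hT : ∀ u, |u - u₀| ≤ δ → ‖P u - P u₀ - b * (u - u₀) + c * (u - u₀) ^ 2‖ ≤ M * |u - u₀| ^ 3)
    {u : ℝ} (hu : |u - u₀| ≤ δ) :
    ‖Complex.exp (P u - P u₀) - Complex.exp (b * (((u : ℂ)) - u₀) - c * (((u : ℂ)) - u₀) ^ 2)‖ ≤
      Real.exp (‖b‖ ^ 2 / c.re) * (M * |u - u₀| ^ 3 * Real.exp (-(c.re / 2) * (u - u₀) ^ 2)) := by
  set z : ℂ := P u - P u₀ - b * (u - u₀) + c * (u - u₀) ^ 2 with hz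
  set G : ℂ := b * (((u : ℂ)) - u₀) - c * (((u : ℂ)) - u₀) ^ 2 with hG
  have hzn : ‖z‖ ≤ M * |u - u₀| ^ 3 := hT u hu
  have hz2 : ‖z‖ ≤ c.re / 4 * (u - u₀) ^ 2 := by
    have habs : |u - u₀| ^ 3 = |u - u₀| * (u - u₀) ^ 2 := by rw [pow_succ', sq_abs]
    calc ‖z‖ ≤ M * |u - u₀| ^ 3 := hzn
      _ = (M * |u - u₀|) * (u - u₀) ^ 2 := by rw [habs, mul_assoc]
      _ ≤ (c.re / 4) * (u - u₀) ^ 2 :=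
          mul_le_mul_of_nonneg_right ((mul_le_mul_of_nonneg_left hu hM).trans hMδ) (sq_nonneg _)
  have hsplit : Complex.exp (P u - P u₀) - Complex.exp G = Complex.exp G * (Complex.exp z - 1) := by
    rw [mul_sub, mul_one, ← Complex.exp_add]
    congr 2
    rw [hz, hG]; ring
  have hGre : ‖Complex.exp G‖ ≤ Real.exp (‖b‖ ^ 2 / c.re - 3 / 4 * c.re * (u - u₀) ^ 2) := by
    rw [Complex.norm_exp]
    apply Real.exp_monotone
    have := re_lin_sub_quad_le (b := b) hc (u - u₀)
    rw [hG]; push_cast at this; exact this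
  have h1 : ‖Complex.exp z - 1‖ ≤ ‖z‖ * Real.exp ‖z‖ := by
    simpa using Complex.norm_exp_sub_sum_le_norm_mul_exp z 1
  have h2 : ‖z‖ * Real.exp ‖z‖ ≤ M * |u - u₀| ^ 3 * Real.exp (c.re / 4 * (u - u₀) ^ 2) :=
    mul_le_mul hzn (Real.exp_monotone hz2) (Real.exp_pos _).le (by positivity)
  rw [hsplit, norm_mul]
  calc ‖Complex.exp G‖ * ‖Complex.exp z - 1‖
      ≤ Real.exp (‖b‖ ^ 2 / c.re - 3 / 4 * c.re * (u - u₀) ^ 2) *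
          (M * |u - u₀| ^ 3 * Real.exp (c.re / 4 * (u - u₀) ^ 2)) :=
        mul_le_mul hGre (h1.trans h2) (norm_nonneg _) (Real.exp_pos _).le
    _ = Real.exp (‖b‖ ^ 2 / c.re) * (M * |u - u₀| ^ 3 * Real.exp (-(c.re / 2) * (u - u₀) ^ 2)) := by
        have : Real.exp (‖b‖ ^ 2 / c.re - 3 / 4 * c.re * (u - u₀) ^ 2) * Real.exp (c.re / 4 * (u - u₀) ^ 2) =
            Real.exp (‖b‖ ^ 2 / c.re) * Real.exp (-(c.re / 2) * (u - u₀) ^ 2) := by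
          rw [← Real.exp_add, ← Real.exp_add]; ring_nf
        calc Real.exp (‖b‖ ^ 2 / c.re - 3 / 4 * c.re * (u - u₀) ^ 2) *
              (M * |u - u₀| ^ 3 * Real.exp (c.re / 4 * (u - u₀) ^ 2))
            = (Real.exp (‖b‖ ^ 2 / c.re - 3 / 4 * c.re * (u - u₀) ^ 2) * Real.exp (c.re / 4 * (u - u₀) ^ 2)) *
                (M * |u - u₀| ^ 3) := by ring
          _ = _ := by rw [this]; ring

/-- **Cubic error on the window, drift allowed.**
`‖∫_{u₀−δ}^{u₀+δ} (e^{P u − P u₀} − e^{b(u−u₀) − c(u−u₀)²}) du‖ ≤ e^{|b|²/Re c}·4M/(Re c)²`. -/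
theorem norm_integral_window_phase_lin_sub_gaussian_le {P : ℝ → ℂ} {u₀ : ℝ} {b c : ℂ} (hc : 0 < c.re)
    {δ M : ℝ} (hM : 0 ≤ M) (hMδ : M * δ ≤ c.re / 4)
    (hT : ∀ u, |u - u₀| ≤ δ → ‖P u - P u₀ - b * (u - u₀) + c * (u - u₀) ^ 2‖ ≤ M * |u - u₀| ^ 3) :
    ‖∫ u in Icc (u₀ - δ) (u₀ + δ),
        (Complex.exp (P u - P u₀) - Complex.exp (b * (((u : ℂ)) - u₀) - c * (((u : ℂ)) - u₀) ^ 2))‖ ≤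
      Real.exp (‖b‖ ^ 2 / c.re) * (4 * M / c.re ^ 2) := by
  have hb2 : 0 < c.re / 2 := by linarith
  set K : ℝ := Real.exp (‖b‖ ^ 2 / c.re) with hK
  set g : ℝ → ℝ := fun u => K * (M * |u - u₀| ^ 3 * Real.exp (-(c.re / 2) * (u - u₀) ^ 2)) with hg
  have hgi : Integrable g := by
    have h := ((integrable_abs_pow_three_mul_exp_neg_mul_sq hb2).comp_sub_right u₀).const_mul (K * M)
    refine h.congr (Eventually.of_forall fun u => ?_)
    simp only [hg]; ring
  have h1 : ‖∫ u in Icc (u₀ - δ) (u₀ + δ),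
        (Complex.exp (P u - P u₀) - Complex.exp (b * (((u : ℂ)) - u₀) - c * (((u : ℂ)) - u₀) ^ 2))‖ ≤
      ∫ u in Icc (u₀ - δ) (u₀ + δ), g u :=
    norm_integral_le_of_norm_le hgi.integrableOn ((ae_restrict_iff' measurableSet_Icc).2
      (Eventually.of_forall fun u hu => norm_cexp_phase_lin_sub_gaussian_le hc hM hMδ hT (abs_sub_le_of_mem_Icc hu)))
  have h2 : (∫ u in Icc (u₀ - δ) (u₀ + δ), g u) ≤ ∫ u, g u :=
    setIntegral_le_integral hgi (Eventually.of_forall fun u => by simp only [hg]; positivity)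
  have h3 : (∫ u, g u) = K * (4 * M / c.re ^ 2) := by
    simp only [hg]
    have : (fun u => K * (M * |u - u₀| ^ 3 * Real.exp (-(c.re / 2) * (u - u₀) ^ 2))) =
        fun u => (K * M) * (|u - u₀| ^ 3 * Real.exp (-(c.re / 2) * (u - u₀) ^ 2)) := by
      ext u; ring
    rw [this, integral_const_mul, integral_abs_sub_pow_three_mul_exp hb2 u₀]
    field_simp
    ring
  linarith

/-- **Drifted Gaussian mass outside the window.**
`‖∫_{u₀−δ}^{u₀+δ} e^{b(u−u₀) − c(u−u₀)²} du − (π/c)^{1/2}e^{b²/(4c)}‖ ≤ e^{|b|²/Re c}·e^{−Re c·δ²/4}·√(2π/Re c)`. -/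
theorem norm_integral_window_gaussian_lin_sub_le {b c : ℂ} (hc : 0 < c.re) (u₀ : ℝ) {δ : ℝ} (hδ : 0 ≤ δ) :
    ‖(∫ u in Icc (u₀ - δ) (u₀ + δ), Complex.exp (b * (((u : ℂ)) - u₀) - c * (((u : ℂ)) - u₀) ^ 2)) -
        (π / c) ^ (1 / 2 : ℂ) * Complex.exp (b ^ 2 / (4 * c))‖ ≤
      Real.exp (‖b‖ ^ 2 / c.re) * Real.exp (-(c.re * δ ^ 2 / 4)) * Real.sqrt (2 * π / c.re) := by
  have hb2 : 0 < c.re / 2 := by linarith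
  have hint := integrable_cexp_lin_sub_quad (b := b) hc u₀
  rw [← integral_cexp_lin_sub_quad hc u₀, ← integral_add_compl (s := Icc (u₀ - δ) (u₀ + δ)) measurableSet_Icc hint,
    sub_add_cancel_left, norm_neg]
  have h := norm_setIntegral_le_of_norm_le_gaussian (measurableSet_Icc (a := u₀ - δ) (b := u₀ + δ)).compl hb2
    (by positivity : 0 ≤ Real.exp (‖b‖ ^ 2 / c.re) * Real.exp (-(c.re * δ ^ 2 / 4))) (x₀ := u₀)
    (f := fun u : ℝ => Complex.exp (b * (((u : ℂ)) - u₀) - c * (((u : ℂ)) - u₀) ^ 2)) (fun u hu => by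
      have hu' : δ ≤ |u - u₀| := by
        rw [mem_compl_iff, mem_Icc, not_and_or, not_le, not_le] at hu
        rcases hu with h | h
        · rw [abs_of_neg (by linarith)]; linarith
        · rw [abs_of_pos (by linarith)]; linarith
      have hsq : δ ^ 2 ≤ (u - u₀) ^ 2 := by
        rw [← sq_abs (u - u₀)]; exact pow_le_pow_left₀ hδ hu' 2
      rw [Complex.norm_exp]
      have hre := re_lin_sub_quad_le (b := b) hc (u - u₀)
      push_cast at hre
      rw [← Real.exp_add, ← Real.exp_add]
      apply Real.exp_monotone
      nlinarith [hc])
  have hsq : Real.sqrt (π / (c.re / 2)) = Real.sqrt (2 * π / c.re) := by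
    congr 1; field_simp
  rwa [hsq] at h

/-- **The main term on the window at an approximate saddle («lineLower» with drift).** Under the window hypotheses
(`‖P u − P u₀ − b(u−u₀) + c(u−u₀)²‖ ≤ M|u−u₀|³` on `|u−u₀| ≤ δ`, `Re c > 0`, `0 ≤ M`, `0 ≤ δ`, `Mδ ≤ Re c/4`):
`‖∫_{u₀−δ}^{u₀+δ} e^{P u − P u₀} du − (π/c)^{1/2}e^{b²/(4c)}‖ ≤ e^{|b|²/Re c}·(4M/(Re c)² + e^{−Re c·δ²/4}√(2π/Re c))`. -/
theorem norm_integral_window_phase_lin_sub_main_le {P : ℝ → ℂ} (hP : Continuous P) {u₀ : ℝ} {b c : ℂ}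
    (hc : 0 < c.re) {δ M : ℝ} (hδ : 0 ≤ δ) (hM : 0 ≤ M) (hMδ : M * δ ≤ c.re / 4)
    (hT : ∀ u, |u - u₀| ≤ δ → ‖P u - P u₀ - b * (u - u₀) + c * (u - u₀) ^ 2‖ ≤ M * |u - u₀| ^ 3) :
    ‖(∫ u in Icc (u₀ - δ) (u₀ + δ), Complex.exp (P u - P u₀)) - (π / c) ^ (1 / 2 : ℂ) * Complex.exp (b ^ 2 / (4 * c))‖ ≤
      Real.exp (‖b‖ ^ 2 / c.re) * (4 * M / c.re ^ 2 + Real.exp (-(c.re * δ ^ 2 / 4)) * Real.sqrt (2 * π / c.re)) := by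
  have hintP : IntegrableOn (fun u : ℝ => Complex.exp (P u - P u₀)) (Icc (u₀ - δ) (u₀ + δ)) :=
    ((hP.sub continuous_const).cexp).continuousOn.integrableOn_compact isCompact_Icc
  have hintG : IntegrableOn (fun u : ℝ => Complex.exp (b * (((u : ℂ)) - u₀) - c * (((u : ℂ)) - u₀) ^ 2))
      (Icc (u₀ - δ) (u₀ + δ)) := (integrable_cexp_lin_sub_quad (b := b) hc u₀).integrableOn
  have hsplit : (∫ u in Icc (u₀ - δ) (u₀ + δ), Complex.exp (P u - P u₀)) -
        (π / c) ^ (1 / 2 : ℂ) * Complex.exp (b ^ 2 / (4 * c)) =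
      (∫ u in Icc (u₀ - δ) (u₀ + δ),
          (Complex.exp (P u - P u₀) - Complex.exp (b * (((u : ℂ)) - u₀) - c * (((u : ℂ)) - u₀) ^ 2))) +
        ((∫ u in Icc (u₀ - δ) (u₀ + δ), Complex.exp (b * (((u : ℂ)) - u₀) - c * (((u : ℂ)) - u₀) ^ 2)) -
          (π / c) ^ (1 / 2 : ℂ) * Complex.exp (b ^ 2 / (4 * c))) := by
    rw [integral_sub hintP hintG]; ring
  rw [hsplit, mul_add]
  refine (norm_add_le _ _).trans (add_le_add (norm_integral_window_phase_lin_sub_gaussian_le hc hM hMδ hT) ?_)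
  have := norm_integral_window_gaussian_lin_sub_le (b := b) hc u₀ hδ
  linarith [this]

end Summit.RiemannHypothesis.RiemannHypothesis.Theorems.JensenPolynomials.WindowEGF

end
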